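import Literature.Analysis.FluidPDE.KNSSLiouville
import HarnessLib

/-!
# KNSS 2009: regularity of bounded weak solutions (§4) and the stability lemma for the strong
# maximum principle (Lemma 2.1), as named facts

Analysis/FluidPDE facts file on the decomposition path of the named facts
`Literature.Analysis.FluidPDE.KNSS2009_liouville_axisymmetric_no_swirl` (Koch–Nadirashvili–
Seregin–Šverák, Acta Math. 203 (2009) = arXiv:0709.3599, Theorem 5.2; it discharges
`Literature.Analysis.FluidPDE.knss2009_axisymmetric_no_swirl` by `KNSSAxisymmetricNoSwirl`) and
`Literature.Analysis.FluidPDE.KNSS2009_liouville_bound_C_over_r` (Theorem 5.3). The printed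
proofs of both theorems (arXiv p. 10) rest on two inputs which are theories of their own and are
vendored here as named facts, in the form in which the proofs consume them:

* `Literature.Analysis.FluidPDE.KNSS2009_regularity_boundedWeak_ancient` — **§4, (4.6)–(4.8) with
  Lemma 3.1 and (4.5), for bounded weak solutions on `ℝ³ × (−∞, 0)`**: "By the results of
  Section 4, we have `|∇ᵏₓu| ≤ C_k` in `ℝ³ × (−∞, 0)`" (first sentence of the proof of
  Theorem 5.2, p. 10). Precisely: a bounded weak solution `u` agrees a.e. with `U + b(t)`, where
  `b` is bounded measurable (the "parasitic" part of Lemma 3.1, p. 7), every slice `U(t, ·)` is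
  smooth with all derivatives bounded uniformly in `t < 0` ((4.7)), the derivatives of order
  `≥ 1` are Lipschitz in time uniformly ((4.8): `∇ᵏₓ∂ₜ(u − b) ∈ L^∞`), `div U(t, ·) = 0`, and the
  vorticity `ω = curl U` satisfies the vorticity equation (4.5),
  `ωₜ − Δω = (ω·∇)u − (u·∇)ω` with `u = U + b`, here in time-integrated form (an identity between
  bounded continuous functions, no distributional derivatives needed).
* `Literature.Analysis.FluidPDE.KNSS2009_lemma21_halfball` — **Lemma 2.1 (p. 5) in the form used
  in the proofs of Theorems 5.1 and 5.2** (p. 9: "By Lemma 2.1 there exist arbitrarily large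
  [parabolic] balls `Q_R = B(x̄, R) × (t̄ − R², t̄)` such that `ω ≥ M₁/2` in `Q_R`"; p. 10:
  "Applying Lemma 2.1 to equation (5.11), considered as an equation in `ℝ⁵ × (−∞, 0)`, we see that
  `ω_θ/r ≥ M₁/2` in arbitrarily large parabolic balls"): a bounded solution of
  `fₜ + a·∇f − Δf = 0` on `ℝⁿ × (−∞, 0)` with bounded measurable drift `a` and `sup f = M₁ > 0` is
  `≥ M₁/2` on parabolic balls of every radius.

Both are stated for explicit, elementary solution classes (everywhere-defined representatives,
classical spatial derivatives, time-integrated equations), so that they can be *applied* without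
a theory of parabolic Sobolev spaces and *attacked* (refuted or discharged) on their own; see the
docstrings for the exact relation to the printed statements. Nothing is proved in this file.

## Why these forms (design notes)

* **Representatives.** KNSS's `u ∈ L^∞(ℝⁿ × (−∞, 0))` is an equivalence class; (4.7)–(4.8) are
  `L^∞` bounds on distributional derivatives. We render them through a representative
  `U : ℝ → ℝ³ → ℝ³` with `u t =ᵐ U t + b t` for a.e. `t < 0`, smooth slices and classical
  derivatives (`iteratedFDeriv`). The slice `U t` itself is *not* asserted Lipschitz in `t`
  (only its derivatives of order `≥ 1` are): the parasitic part `b` of Lemma 3.1 is determined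
  only up to constants on each time window (Remark 3.1), and a global choice on `(−∞, 0)` may be
  glued from windows at the price of `x`-independent jumps of `U`, which no derivative and no
  clause below sees (`U + b = u` has no jumps).
* **The vorticity equation** is recorded in integrated form
  `ω(t) − ω(s) = ∫ₛᵗ (Δω − Dω[U + b] + DU[ω]) dτ` pointwise in `x` (KNSS: (4.5) "is satisfied in
  the sense of distributions", which with (4.7)–(4.8) is equivalent to this identity).
* **Lemma 2.1** is printed for weak solutions (`u, ∇u ∈ L²_loc`, bounded measurable `a`) on
  bounded cylinders `Ω × (0, T)`, with constants `δ(Ω, Ω', K, T, ‖a‖_∞, τ, ε)`. The proofs of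
  Theorems 5.1–5.3 use it only through the consequence vendored here (translate a near-supremum
  point to the centre of a fixed configuration `Ω = B_{2R}`, `Ω' = B_R`, `K = {centre}`,
  `T = 2R²`, `τ = R²`, after replacing `f` by `f − inf f ≥ 0` so that `sup |f| = sup f`). The
  solution class (bounded, `C²` slices, bounded continuous `∇f`, `Δf`, integrated equation) is
  contained in KNSS's weak class, so the fact is implied by the printed lemma.

## References

* G. Koch, N. Nadirashvili, G. Seregin, V. Šverák, *Liouville theorems for the Navier–Stokes
  equations and applications*, Acta Math. 203 (2009) 83–105 = arXiv:0709.3599 (arXiv page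
  numbers): §2 Lemma 2.1 (p. 5); §3 Lemma 3.1 and Remark 3.1 (p. 7); §4 (4.5)–(4.8) (p. 8);
  §5, proofs of Theorems 5.1 (p. 9) and 5.2–5.3 (p. 10). [KochNadirashviliSereginSverak2009]
* O. A. Ladyzhenskaya, V. A. Solonnikov, N. N. Ural'ceva, *Linear and quasilinear equations of
  parabolic type* (AMS 1968) — KNSS's reference [LSU] for the regularity behind Lemma 2.1.
-/

noncomputable section

open MeasureTheory Set Function Filter TopologicalSpace InnerProductSpace
open scoped RealInnerProductSpace Laplacian ContDiff

namespace Literature.Analysis.FluidPDE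

/-! ### §4: regularity of bounded weak solutions on `ℝ³ × (−∞, 0)` -/

section Regularity

/-- **KNSS 2009, §4 (regularity of bounded weak solutions), ancient form used in the proof of
Theorem 5.2** (Acta Math. 203 (2009) = arXiv:0709.3599; §4 p. 8, (4.6)–(4.8) with Lemma 3.1
p. 7 and the vorticity equation (4.5); §5 p. 10, first sentence of the proof of Theorem 5.2: "By
the results of Section 4, we have `|∇ᵏₓu| ≤ C_k` in `ℝ³ × (−∞, 0)`"). Let `u` be a bounded weak
solution of the Navier–Stokes equations (`ν = 1`) in `ℝ³ × (−∞, 0)`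
(`Fluid.IsBoundedWeakNSSolutionOn (Iio 0)`). Then there are a velocity representative
`U : ℝ → ℝ³ → ℝ³` and a bounded measurable `b : ℝ → ℝ³` (the parasitic part of Lemma 3.1:
`u = v + w + b(t)`) such that:
* `u(t, ·) = U(t, ·) + b(t)` a.e. in `x`, for a.e. `t < 0`, and `(t, x) ↦ U(t, x)` is (jointly)
  measurable (free in the source's construction `U = v + w`, Lemma 3.1; recorded so that the
  drifts built from `U` and `b` are measurable — revision note: this clause was added right
  after the fact landed, before any consumer, on the reviewer's suggestion);
* every slice `U(t, ·)`, `t < 0`, is `C^∞` and divergence free, and for every `k` the `k`-th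
  derivatives are bounded on `ℝ³ × (−∞, 0)` ((4.7), uniform on `(−∞, 0)` for an ancient solution,
  as asserted on p. 10);
* for every `k ≥ 1` the `k`-th spatial derivatives are Lipschitz in time, uniformly
  ((4.8): `‖∇ᵏₓ∂ₜ(u − b)‖_{L^∞} ≤ C`; order `0` is deliberately not asserted, module docstring);
* the vorticity `ω = curl U` satisfies the vorticity equation (4.5),
  `ωₜ = Δω − (u·∇)ω + (ω·∇)u` with `u = U + b` (so `(ω·∇)u = DU[ω]`), in time-integrated form:
  `ω(t, x) − ω(s, x) = ∫ₛᵗ (Δω(τ, ·)(x) − Dω(τ, ·)(x)[U(τ, x) + b(τ)] + DU(τ, ·)(x)[ω(τ, x)]) dτ`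
  for all `x` and `s ≤ t < 0`.
This compresses Lemma 3.1, Proposition 4.1 and the bootstrap (4.4)–(4.8) (Oseen kernel estimates
(3.5)–(3.10), Serrin's interior regularity); none of it is in Mathlib or the tree. [cite: KochNadirashviliSereginSverak2009, §4 (4.5)–(4.8) p. 8 with Lemma 3.1 p. 7; §5 proof of Thm 5.2, first sentence (arXiv p. 10)] -/
def KNSS2009_regularity_boundedWeak_ancient : Prop :=
  ∀ ⦃u : ℝ → EuclideanSpace ℝ (Fin 3) → EuclideanSpace ℝ (Fin 3)⦄,
    IsBoundedWeakNSSolutionOn (Iio 0) isOpen_Iio 1 u →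
    ∃ (U : ℝ → EuclideanSpace ℝ (Fin 3) → EuclideanSpace ℝ (Fin 3))
      (b : ℝ → EuclideanSpace ℝ (Fin 3)),
      Measurable b ∧ (∃ C : ℝ, ∀ t, ‖b t‖ ≤ C) ∧ Measurable (uncurry U) ∧
      (∀ᵐ t ∂((volume : Measure ℝ).restrict (Iio 0)), u t =ᵐ[volume] fun x => U t x + b t) ∧
      (∀ t < 0, ContDiff ℝ ∞ (U t)) ∧
      (∀ t < 0, VectorCalculus.IsDivFree (U t)) ∧
      (∀ k : ℕ, ∃ C : ℝ, ∀ t < 0, ∀ x, ‖iteratedFDeriv ℝ k (U t) x‖ ≤ C) ∧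
      (∀ k : ℕ, 1 ≤ k → ∃ L : ℝ, ∀ s < 0, ∀ t < 0, ∀ x,
        ‖iteratedFDeriv ℝ k (U t) x - iteratedFDeriv ℝ k (U s) x‖ ≤ L * |t - s|) ∧
      (∀ x, ∀ s t : ℝ, s ≤ t → t < 0 →
        curl (U t) x - curl (U s) x =
          ∫ τ in s..t, ((Δ (curl (U τ))) x - fderiv ℝ (curl (U τ)) x (U τ x + b τ) +
            fderiv ℝ (U τ) x (curl (U τ) x)))

end Regularity

/-! ### Lemma 2.1: stability of the strong maximum principle, in the form used in §5 -/

section MaximumPrinciple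

variable (E : Type*) [NormedAddCommGroup E] [InnerProductSpace ℝ E] [FiniteDimensional ℝ E]
  [MeasurableSpace E] [BorelSpace E]

/-- **KNSS 2009, Lemma 2.1 (stability of the strong maximum principle), in the form used in the
proofs of Theorems 5.1–5.2** (Acta Math. 203 (2009) = arXiv:0709.3599. Lemma 2.1, p. 5: for the
equation `uₜ + a·∇u − Δu = 0` with bounded measurable `a` in `Ω × (0, T)`, `K ⊂ Ω` compact,
`Ω' ⊂⊂ Ω`, `τ > 0`: "for each `ε > 0` there exists `δ = δ(Ω, Ω', K, T, ‖a‖_∞, τ, ε) > 0` such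
that if `u` is a bounded solution with `sup |u| = M` and `sup_{x ∈ K} u(x, T) ≥ M(1 − δ)`, then
`u ≥ M(1 − ε)` in `Ω' × (τ, T)`". Its use, p. 9, proof of Theorem 5.1: "Let `M₁ = sup ω` … and
assume that `M₁ > 0`. By Lemma 2.1 there exist arbitrarily large balls
`Q_R = B(x̄, R) × (t̄ − R², t̄)` such that `ω ≥ M₁/2` in `Q_R`"; likewise p. 10, proof of
Theorem 5.2, in `ℝ⁵ × (−∞, 0)`.) **Statement.** On a finite-dimensional real inner product space
`E` (KNSS: `ℝⁿ`), let `a : ℝ → E → E` be jointly measurable with `‖a(t, y)‖ ≤ A` for `t < 0`, and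
let `f : ℝ → E → ℝ` be a bounded solution of `fₜ + a·∇f − Δf = 0` on `E × (−∞, 0)` in the
following elementary class: every slice `f(t, ·)`, `t < 0`, is `C²`; `∇f` and `Δf` are bounded
and jointly continuous on `(−∞, 0) × E`; and the equation holds in time-integrated form,
`f(t, y) − f(s, y) = ∫ₛᵗ (Δf(τ, ·)(y) − Df(τ, ·)(y)[a(τ, y)]) dτ` for all `y` and `s ≤ t < 0` (such
an `f` is Lipschitz in `t`, hence a bounded weak solution in the sense of §2, p. 5). If
`M₁ = sup_{t<0, y} f(t, y) > 0`, then for every `R > 0` there are `ȳ ∈ E` and `t̄ < 0` with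
`f ≥ M₁/2` on the parabolic ball `B(ȳ, R) × (t̄ − R², t̄)`. (Derivation from the printed lemma:
replace `f` by `f − inf f ≥ 0`, so that `sup |f| = sup f`; translate a point where `f` is within
`δ · sup f` of its supremum to the top centre of the fixed configuration `Ω = B_{2R}`, `Ω' = B_R`,
`K = {centre}`, `T = 2R²`, `τ = R²`, and apply Lemma 2.1 with `ε = M₁ / (4 sup(f − inf f))` and
`δ ≤ ε`.) The supremum is rendered by an upper bound `M₁` that is approached. [cite: KochNadirashviliSereginSverak2009, Lemma 2.1 (arXiv p. 5) and proofs of Thms 5.1–5.2 (pp. 9–10)] -/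
def KNSS2009_lemma21_halfball : Prop :=
  ∀ ⦃f : ℝ → E → ℝ⦄ ⦃a : ℝ → E → E⦄ ⦃A M₁ : ℝ⦄,
    -- the drift: jointly measurable and bounded on `(−∞, 0) × E`
    Measurable (uncurry a) → (∀ t < 0, ∀ y, ‖a t y‖ ≤ A) →
    -- the solution class
    (∃ C : ℝ, ∀ t < 0, ∀ y, |f t y| ≤ C) →
    (∀ t < 0, ContDiff ℝ 2 (f t)) →
    (∃ C : ℝ, ∀ t < 0, ∀ y, ‖fderiv ℝ (f t) y‖ ≤ C ∧ |(Δ (f t)) y| ≤ C) →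
    ContinuousOn (fun p : ℝ × E => fderiv ℝ (f p.1) p.2) (Iio 0 ×ˢ univ) →
    ContinuousOn (fun p : ℝ × E => (Δ (f p.1)) p.2) (Iio 0 ×ˢ univ) →
    -- the equation `fₜ + a·∇f − Δf = 0`, integrated in time
    (∀ y, ∀ s t : ℝ, s ≤ t → t < 0 →
      f t y - f s y = ∫ τ in s..t, ((Δ (f τ)) y - fderiv ℝ (f τ) y (a τ y))) →
    -- `M₁ = sup f > 0`
    (∀ t < 0, ∀ y, f t y ≤ M₁) → (∀ ε > 0, ∃ t < 0, ∃ y, M₁ - ε < f t y) → 0 < M₁ →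
    ∀ R > 0, ∃ y₀ : E, ∃ t₀ < (0 : ℝ),
      ∀ t ∈ Ioo (t₀ - R ^ 2) t₀, ∀ y ∈ Metric.ball y₀ R, M₁ / 2 ≤ f t y

end MaximumPrinciple

end Literature.Analysis.FluidPDE

end
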